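import Literature.AlgebraicGeometry.Frobenioids.BirationalizationBiratData
import Literature.AlgebraicGeometry.Frobenioids.ModelFrobenioidMap
import Literature.AlgebraicGeometry.Frobenioids.ModelFrobenioidNormalized
import Literature.AlgebraicGeometry.Frobenioids.ModelFrobenioidPreFrobenioid
import HarnessLib

/-!
# Frobenioids I, Theorem 5.2 (ii): a model Frobenioid is of birationally Frobenius-normalized type

Mochizuki, *The geometry of Frobenioids I: the general theory*, Kyushu J. Math. **62** (2008)
293–400, §5, Theorem 5.2 (ii), kurims p. 101 [cite: MochizukiFrdI2008, Thm. 5.2 (ii) p.101]: "`C` is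
a Frobenioid of isotropic and model — hence birationally Frobenius-normalized [cf. Definition 4.5, (i)]
— type", where (Def. 4.5 (i), p. 86) an object `A` is *birationally Frobenius-normalized* if its image
in the birationalization `C^birat` is Frobenius-normalized (Def. 1.2 (iv): `α^d ∘ φ = φ ∘ α` for every
base-identity endomorphism `φ` of Frobenius degree `d` and every `α ∈ O^▷`).

PROOF-ONLY file (node `FrdI:Thm5.2(ii)`, item F-D1b "birationally Frobenius-normalized", PIECE offered
by seat abc-iut-found 2026-08-25T22:14:33Z and taken by abc-iut-L1-d10) for the model Frobenioid
`C = ModelFrobenioid Φ B Div_B` (seat abc-iut-L1-t2) in seat abc-iut-L1-t3's Def. 4.5 (i) vocabulary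
`PreFrobenioidData.IsOfBiratFrobeniusNormalizedType` AT THE birationalization — seat abc-iut-L6-t8's
`C^birat = PreFrobenioid.Birat` / `C → C^birat = PreFrobenioid.toBirat` packaged by seat abc-iut-L6-t6
as `PreFrobenioid.biratData hF hsq` (rulings C5′/C5‴). ROUTE ("`C^birat` is the model Frobenioid with
`Φ` killed", the content of the "Moreover" of Thm. 5.2 (ii)): the morphism of model data
`(Φ, B, Div_B) → (0_D, B, Div_B ≫ (Φ → 0_D)^gp)` (seat abc-iut-L1-t5's `ModelFrobenioid.DataHom.functor`)
sends co-angular pre-steps to isomorphisms (`B` group-like), hence (universal property of `C^birat`,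
`PreFrobenioid.Birat.lift`, seat abc-iut-L6-t6) induces a comparison functor `Ψ : C^birat → C₀` to the
model Frobenioid `C₀` of those data, compatible with base maps and Frobenius degrees; `Ψ` is FAITHFUL
(`Birat.lift_faithful_of_faithful`: a lift of a faithful functor is faithful, by the common-refinement
property of `C^coa-pre_A`; the data functor is faithful because `Div(φ)` is recovered from
`deg_Fr, Base, u_φ` by relation (d) when `Φ` is integral); and every object of a model Frobenioid is
Frobenius-normalized (seat abc-iut-L1-d8's `ModelFrobenioid.isFrobeniusNormalized`), so the required
identity holds after `Ψ`, hence before. The Frobenioid hypothesis `hF` on `C → F_Φ` (Thm. 5.2 (ii),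
seat abc-iut-found) and the square-completion hypothesis `hsq` of the birationalization are taken as
ARGUMENTS (both discharged in the tree / staging for every model Frobenioid of divisorial `Φ`,
group-like `B` over a connected totally epimorphic base). No definitions.
-/

namespace Literature.AlgebraicGeometry.Frobenioids

open CategoryTheory Opposite

universe w v v' u u' v₃ u₃

/-! ### A lift to `C^birat` of a faithful functor is faithful -/

namespace PreFrobenioid

variable {D : Type u} [Category.{v} D] {Φ : Dᵒᵖ ⥤ CommMonCat.{w}}
  {C : Type u'} [Category.{v'} C] {F : C ⥤ ElemFrobenioid Φ}
  {hF : IsFrobenioid F} {hsq : HasBiratSquares F}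
  {E : Type u₃} [Category.{v₃} E]

/-- If `G : C → E` inverts the co-angular pre-steps and is FAITHFUL, then the induced functor
`C^birat → E` ([FrdI] Prop. 4.4 (i), universal property) is faithful: two fractions can be written
over a common co-angular pre-step (directedness of `C^coa-pre_A`, Def. 1.3 (iii)(d)), and then their
images agree iff their numerators do. [cite: MochizukiFrdI2008, Prop. 4.4 (i) p.82] -/
theorem Birat.lift_faithful_of_faithful (G : C ⥤ E) (hG : (coAngularPreSteps F).IsInvertedBy G)
    [G.Faithful] : (Birat.lift hF hsq G hG).Faithful := by
  refine ⟨fun {X Y} g₁ g₂ h => ?_⟩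
  obtain ⟨f₁, rfl⟩ := Birat.homMk_surjective g₁
  obtain ⟨f₂, rfl⟩ := Birat.homMk_surjective g₂
  obtain ⟨T, κ, κ', hκ, hκ', hden⟩ :=
    exists_common_refinement hF f₁.den f₂.den f₁.den_mem f₂.den_mem
  rw [Birat.lift_map_homMk, Birat.lift_map_homMk,
    Birat.liftMap_restrict (hF := hF) G hG f₁ κ hκ,
    Birat.liftMap_restrict (hF := hF) G hG f₂ κ' hκ'] at h
  haveI := hG _ (hκ.comp hF f₁.den_mem)
  haveI := hG _ (hκ'.comp hF f₂.den_mem)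
  have h₁ : G.map (κ ≫ f₁.num) =
      G.map (κ ≫ f₁.den) ≫ inv (G.map (κ' ≫ f₂.den)) ≫ G.map (κ' ≫ f₂.num) :=
    (IsIso.inv_comp_eq _).mp h
  have hGden : G.map (κ ≫ f₁.den) = G.map (κ' ≫ f₂.den) := by rw [hden]
  rw [hGden, IsIso.hom_inv_id_assoc] at h₁
  exact Birat.homMk_sound ⟨T, κ, κ', hκ, hκ', hden, G.map_injective h₁⟩

end PreFrobenioid

/-! ### The functor induced by a morphism of model data: faithfulness, pre-steps -/

namespace ModelFrobenioid

variable {D : Type u} [Category.{v} D] {Φ B Φ' B' : Dᵒᵖ ⥤ CommMonCat.{w}}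
  {DivB : B ⟶ monoidGp Φ} {DivB' : B' ⟶ monoidGp Φ'}

namespace DataHom

/-- The functor of model Frobenioids induced by a morphism of model data `(η, β)` is FAITHFUL as soon as
`β` is injective and `Φ` is integral: `(deg_Fr, Base, u_φ)` are read off the image, and `Div(φ)` is then
recovered from relation (d) `deg_Fr(φ)·α + Div(φ) = Φ(Base φ)(β) + Div_B(u_φ)` of Thm. 5.2 (i).
[cite: MochizukiFrdI2008, Thm. 5.2 (i) p.100] -/
theorem functor_faithful (h : DataHom DivB DivB')
    (hβ : ∀ A : Dᵒᵖ, Function.Injective (h.β.app A).hom)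
    (hΦ : ∀ X : D, IsCancelMul (Φ.obj (op X))) : h.functor.Faithful := by
  refine ⟨fun {X Y} φ ψ e => ?_⟩
  have e' : h.mapHom φ = h.mapHom ψ := e
  have h₁ : degFr φ = degFr ψ := by
    have t := congrArg Hom.degFr e'; dsimp only [DataHom.mapHom] at t; exact t
  have h₂ : baseMap φ = baseMap ψ := by
    have t := congrArg Hom.base e'; dsimp only [DataHom.mapHom] at t; exact t
  have h₄ : unit φ = unit ψ := by
    have t := congrArg Hom.unit e'; dsimp only [DataHom.mapHom] at t; exact hβ _ t
  have h₃ : div φ = div ψ := by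
    haveI := hΦ X.base
    apply Algebra.GrothendieckGroup.of_injective (M := Φ.obj (op X.base))
    have r₁ := rel φ
    have r₂ := rel ψ
    rw [h₁, h₂, h₄, ← r₂] at r₁
    exact mul_left_cancel r₁
  exact hom_ext h₁ h₂ h₃ h₄

/-- If the target divisor monoid is trivial and the target `B'` is group-like, the induced functor sends
every co-angular pre-step (indeed every pre-step: Frobenius degree `1`, base-isomorphism) to an
ISOMORPHISM — "pre-steps of `C` map to isomorphisms in `C^birat`" (Prop. 4.4 (iv)) for the model with
`Φ` killed. [cite: MochizukiFrdI2008, Prop. 4.4 (iv) p.83] -/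
theorem isIso_functor_map (h : DataHom DivB DivB') (hΦ' : ∀ (A : Dᵒᵖ) (x : Φ'.obj A), x = 1)
    (hB'g : Objectwise (fun M _ => IsGroupLike M) B') {X Y : ModelFrobenioid Φ B DivB} (s : X ⟶ Y)
    (hs : PreFrobenioid.IsPreStep (toElem Φ B DivB) s) : IsIso (h.functor.map s) := by
  haveI : IsIso (baseMap (h.functor.map s)) := hs.2
  exact isIso_of hB'g _ (hΦ' _ _) hs.1

end DataHom

/-! ### Theorem 5.2 (ii): birationally Frobenius-normalized -/

variable (Φ B DivB) in
/-- **Thm. 5.2 (ii), "model — hence birationally Frobenius-normalized — type"** (p. 101; Def. 4.5 (i)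
p. 86): every object of the model Frobenioid `C` of `(Φ, B, Div_B)` is birationally Frobenius-normalized,
i.e. its image in THE birationalization `C^birat` (seat abc-iut-L6-t8/L6-t6 `PreFrobenioid.biratData`)
is Frobenius-normalized for the pre-Frobenioid structure `C^birat → F_{0_D}` — for `Φ` integral
(e.g. divisorial) and `B` group-like, given that `C → F_Φ` is a Frobenioid (`hF`, Thm. 5.2 (ii), seat
abc-iut-found) with the square-completion property `hsq` (Prop. 1.11 (vii)).
[cite: MochizukiFrdI2008, Thm. 5.2 (ii) p.101] -/
theorem isOfBiratFrobeniusNormalizedType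
    (hF : PreFrobenioid.IsFrobenioid (toElem Φ B DivB))
    (hsq : PreFrobenioid.HasBiratSquares (toElem Φ B DivB))
    (hΦ : ∀ X : D, IsCancelMul (Φ.obj (op X)))
    (hBg : Objectwise (fun M _ => IsGroupLike M) B) :
    PreFrobenioidData.IsOfBiratFrobeniusNormalizedType (PreFrobenioid.biratData hF hsq) := by
  -- the model data with `Φ` killed: `(0_D, B, Div_B ≫ (Φ → 0_D)^gp)`, and the comparison functor
  let DivB₀ : B ⟶ monoidGp (zeroMonoid.{w} D) :=
    DivB ≫ Functor.whiskerRight (toZeroMonoid Φ) MonGp.functor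
  let h : DataHom DivB DivB₀ := ⟨toZeroMonoid Φ, 𝟙 B, fun A u => rfl⟩
  have hG : (PreFrobenioid.coAngularPreSteps (toElem Φ B DivB)).IsInvertedBy h.functor :=
    fun X Y s hs => h.isIso_functor_map (fun _ _ => rfl) hBg s hs.2
  haveI : h.functor.Faithful := h.functor_faithful (fun A => fun a b e => e) hΦ
  let Ψ := PreFrobenioid.Birat.lift hF hsq h.functor hG
  haveI : Ψ.Faithful := PreFrobenioid.Birat.lift_faithful_of_faithful h.functor hG
  -- `Ψ` on a class of fractions, its Frobenius degree and base map
  have hΨ : ∀ {X Y : PreFrobenioid.Birat (toElem Φ B DivB) hF hsq}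
      (f : PreFrobenioid.BiratFrac (toElem Φ B DivB) X.out Y.out),
      Ψ.map (PreFrobenioid.Birat.homMk f) =
        (haveI := hG f.den f.den_mem; inv (h.functor.map f.den) ≫ h.functor.map f.num) :=
    fun f => rfl
  have hdeg : ∀ {X Y : PreFrobenioid.Birat (toElem Φ B DivB) hF hsq}
      (f : PreFrobenioid.BiratFrac (toElem Φ B DivB) X.out Y.out),
      degFr (Ψ.map (PreFrobenioid.Birat.homMk f)) = PreFrobenioid.BiratFrac.deg f := by
    intro X Y f
    haveI := hG f.den f.den_mem
    rw [hΨ, degFr_comp, degFr_eq_one_of_isIso (inv (h.functor.map f.den)), mul_one]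
    rfl
  have hbase : ∀ {X Y : PreFrobenioid.Birat (toElem Φ B DivB) hF hsq}
      (f : PreFrobenioid.BiratFrac (toElem Φ B DivB) X.out Y.out),
      baseMap (Ψ.map (PreFrobenioid.Birat.homMk f)) = PreFrobenioid.BiratFrac.base f := by
    intro X Y f
    haveI := hG f.den f.den_mem
    haveI : IsIso (baseMap (h.functor.map f.den)) := isIso_baseMap_of_isIso _
    rw [hΨ, baseMap_comp]
    have e : baseMap (inv (h.functor.map f.den)) = inv (baseMap (h.functor.map f.den)) :=
      (baseFunctor (zeroMonoid.{w} D) B DivB₀).map_inv (h.functor.map f.den)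
    rw [e]
    rfl
  -- the object-wise statement
  refine ⟨fun A => ?_⟩
  change (PreFrobenioid.biratOps hF hsq).IsFrobeniusNormalized
    ((PreFrobenioid.toBirat (toElem Φ B DivB) hF hsq).obj A)
  intro φ hφ α hα
  obtain ⟨f, rfl⟩ := PreFrobenioid.Birat.homMk_surjective φ
  obtain ⟨a, rfl⟩ := PreFrobenioid.Birat.homMk_surjective α
  -- transfer the hypotheses to `C₀`
  have hφ₀ : PreFrobenioid.IsBaseIdentity (toElem (zeroMonoid.{w} D) B DivB₀)
      (Ψ.map (PreFrobenioid.Birat.homMk f)) := by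
    change baseMap (Ψ.map (PreFrobenioid.Birat.homMk f)) = 𝟙 _
    rw [hbase]
    exact hφ
  have hα₀ : (Ψ.map (PreFrobenioid.Birat.homMk a) :
        End (Ψ.obj ((PreFrobenioid.toBirat _ hF hsq).obj A)))
      ∈ PreFrobenioid.endSubmonoid (toElem (zeroMonoid.{w} D) B DivB₀) _ := by
    refine ⟨?_, ?_⟩
    · change baseMap (Ψ.map (PreFrobenioid.Birat.homMk a)) = 𝟙 _
      rw [hbase]
      exact hα.1
    · change degFr (Ψ.map (PreFrobenioid.Birat.homMk a)) = 1
      rw [hdeg]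
      exact hα.2
  have hd : PreFrobenioid.degFr (toElem (zeroMonoid.{w} D) B DivB₀)
        (Ψ.map (PreFrobenioid.Birat.homMk f)) =
      (PreFrobenioid.biratOps hF hsq).degFr (PreFrobenioid.Birat.homMk f) := by
    change degFr (Ψ.map (PreFrobenioid.Birat.homMk f)) = PreFrobenioid.BiratFrac.deg f
    rw [hdeg]
  -- Frobenius-normalization in `C₀`, pulled back along the faithful `Ψ`
  have key := isFrobeniusNormalized (Ψ.obj ((PreFrobenioid.toBirat _ hF hsq).obj A))
    (Ψ.map (PreFrobenioid.Birat.homMk f)) hφ₀ _ hα₀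
  dsimp only at key
  have hinj : Function.Injective (Ψ.mapEnd ((PreFrobenioid.toBirat _ hF hsq).obj A)) :=
    fun x y hxy => Ψ.map_injective hxy
  apply hinj
  rw [map_mul, map_mul, map_pow]
  simp only [Functor.mapEnd_apply]
  rw [End.mul_def, End.mul_def, ← hd]
  exact key

variable (Φ B DivB) in
/-- **Thm. 5.2 (ii)**, object form: every object `(A_D, α)` of the model Frobenioid is birationally
Frobenius-normalized (Def. 4.5 (i)). [cite: MochizukiFrdI2008, Thm. 5.2 (ii) p.101] -/
theorem isBiratFrobeniusNormalizedObj
    (hF : PreFrobenioid.IsFrobenioid (toElem Φ B DivB))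
    (hsq : PreFrobenioid.HasBiratSquares (toElem Φ B DivB))
    (hΦ : ∀ X : D, IsCancelMul (Φ.obj (op X)))
    (hBg : Objectwise (fun M _ => IsGroupLike M) B) (X : ModelFrobenioid Φ B DivB) :
    PreFrobenioidData.IsBiratFrobeniusNormalizedObj (PreFrobenioid.biratData hF hsq) X :=
  (isOfBiratFrobeniusNormalizedType Φ B DivB hF hsq hΦ hBg).obj X

/-- **Thm. 5.2 (ii)** under the standing hypotheses in divisorial form: `Φ` divisorial (hence integral,
i.e. cancellative) and `B` group-like. [cite: MochizukiFrdI2008, Thm. 5.2 (ii) p.101] -/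
theorem isOfBiratFrobeniusNormalizedType_of_isDivisorial
    (hF : PreFrobenioid.IsFrobenioid (toElem Φ B DivB))
    (hsq : PreFrobenioid.HasBiratSquares (toElem Φ B DivB))
    (hΦd : Objectwise (fun M _ => IsDivisorial M) Φ)
    (hBg : Objectwise (fun M _ => IsGroupLike M) B) :
    PreFrobenioidData.IsOfBiratFrobeniusNormalizedType (PreFrobenioid.biratData hF hsq) :=
  isOfBiratFrobeniusNormalizedType Φ B DivB hF hsq
    (fun X => isIntegral_iff_isCancelMul.mp (hΦd X).isPreDivisorial.isIntegral) hBg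

end ModelFrobenioid

end Literature.AlgebraicGeometry.Frobenioids
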